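import Mathlib
import Summits.CriticalPhenomena.PercolationContinuityZ3.Theorems.PercNearOneGluingNoHeavyLowerTailObserverUnionBoundG
import HarnessLib

/-!
# `NoHeavyLowerTail` (stmt-CriticalPhenomena-4575) — the MARKOV first-edge bound: a `G`-form one-layer step whose
# constant is the observer's attachment weight, not its degree

Seat `prim-cplus-engine` gen 7, 2026-08-19 (`--supports stmt-CriticalPhenomena-4575`).  No definitions, no named facts,
no sorries.  Sequel of `…ObserverUnionBoundG.lean` (the `G ∖ e`-form union bound).

Finite weighted graph on `Fin n`, `μ_w = prodBernoulli w`, relays `A`, observer `o ∉ A` with `w(o,x) < 1` for all `x`,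
`N_o = |C(o) ∩ A|`, `δ₀ = μ_w(N_o = 0) = μ_w((⋃_a {o ↔ a})ᶜ)`, and the ATTACHMENT WEIGHTS `α_x := −log(1 − w(o,x)) ≥ 0`
of the pairs at `o` (`∏_{x ∈ R}(1 − w(o,x)) = e^{−Σ_{x∈R} α_x}`).  `G ∖ e` = `pinW w {e} ∅` (one pair closed).

* `lowerTail_le_markov_firstEdge` — **for every `λ > 0`:**
      `μ_w(1 ≤ N_o ≤ j) ≤ e^{2λ} · δ₀ + e^{−λ} + (1/λ) · Σ_{x ≠ o} α_x · μ_{G ∖ s(o,x)}(1 ≤ N_x ≤ j)`.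
  PROOF (three lines of probability).  Condition on the configuration `η` off `o`; let `S` be the set of neighbours
  `x` of `o` attached to `A` off `o`, split as `S = S_h ⊔ S_ℓ` (heavy: `|π_{off o}(x)| > j`; light: `1 ≤ |π_{off o}(x)| ≤ j`),
  and `q(R) := ∏_{x∈R}(1 − w(o,x))`.  Then `μ(N_o = 0 | η) = q(S)` and `μ(1 ≤ N_o ≤ j | η) ≤ q(S_h)` (an open pair to a
  heavy attached neighbour makes `N_o > j`).  (i) On `{q(S) ≥ e^{−2λ}}`: mass `≤ e^{2λ} Σ_η μ[η] q(S) = e^{2λ} δ₀`.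
  (ii) On `{q(S_h) < e^{−λ}}`: `≤ e^{−λ}`.  (iii) Otherwise `q(S_ℓ) < e^{−λ}`, i.e. `Σ_{x ∈ S_ℓ} α_x > λ`; and ON THE BAD
  EVENT every light attached neighbour `x` is light in `G ∖ s(o,x)` (`1 ≤ N_x(ω ∖ s(o,x)) ≤ j`: its `G ∖ s(o,x)`-cluster
  is either its off-`o` cluster or contains `o`, whose cluster has `≤ j` relays), so this part is
  `≤ μ(Σ_x α_x 1{1 ≤ N_x(ω∖s(o,x)) ≤ j} > λ) ≤ (1/λ) Σ_x α_x μ_{G∖s(o,x)}(1 ≤ N_x ≤ j)` by Markov's inequality.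
* The spider corollary (`(r, L)`-uniform for individually reliable legs) is in the sequel
  `…MarkovFirstEdgeSpider.lean` (`MarkovFirstEdge.spider_lowerTail_le_markov`).

READING.  In the union bounds `μ(1 ≤ N_o ≤ j) ≤ Σ_x w(o,x)·(defect of x)` (`…ObserverUnionBound[G]`) the constant
is the weighted DEGREE of `o`; here the defects are divided by `λ`, which may be taken up to a third of `log(1/δ₀)`,
the observer's useful attachment weight — see the spider sequel for the `(r, L)`-uniform consequence.  A ONE-LAYER
tool: iterated over branching levels the factor per level exceeds `1`.
-/

namespace Summit.CriticalPhenomena.PercolationContinuityZ3.Theorems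

open MeasureTheory Set
open Literature.Probability.LatticeModels (prodBernoulli prodBernoulli_real_forall_notMem
  prodBernoulli_real_inter_of_determinedBy)
open Literature.Probability.Percolation

noncomputable section
open Classical

variable {n : ℕ}

namespace MarkovFirstEdge

/-! ### Two general tools -/

/-- **Weighted Markov inequality for a finite sum of indicators**: if `c ≤ Σ_k α_k 1_{E_k}` on `S` with `α_k ≥ 0`,
then `c · μ(S) ≤ Σ_k α_k μ(S ∩ E_k)`. [folklore] -/
theorem mul_measureReal_le_sum_weighted {α κ : Type*} [MeasurableSpace α]
    (μ : Measure α) [IsFiniteMeasure μ] (s : Finset κ) (E : κ → Set α) (a : κ → ℝ) (ha : ∀ k ∈ s, 0 ≤ a k)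
    (hE : ∀ k ∈ s, MeasurableSet (E k)) {S : Set α} (hS : MeasurableSet S) (c : ℝ)
    (hc : ∀ ω ∈ S, c ≤ ∑ k ∈ s, (E k).indicator (fun _ => a k) ω) :
    c * μ.real S ≤ ∑ k ∈ s, a k * μ.real (S ∩ E k) := by
  have hint : ∀ k ∈ s, Integrable ((S ∩ E k).indicator fun _ => a k) μ :=
    fun k hk => (integrable_const (a k)).indicator (hS.inter (hE k hk))
  have h1 : ∀ k ∈ s, a k * μ.real (S ∩ E k) = ∫ ω, (S ∩ E k).indicator (fun _ => a k) ω ∂μ := by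
    intro k hk
    rw [integral_indicator_const _ (hS.inter (hE k hk)), smul_eq_mul, mul_comm]
  have h2 : c * μ.real S = ∫ ω, S.indicator (fun _ => c) ω ∂μ := by
    rw [integral_indicator_const _ hS, smul_eq_mul, mul_comm]
  rw [h2, Finset.sum_congr rfl h1, ← integral_finsetSum s hint]
  refine integral_mono ((integrable_const c).indicator hS) (integrable_finsetSum s hint) ?_
  intro ω
  by_cases hω : ω ∈ S
  · simp only [Set.indicator_of_mem hω]
    refine le_trans (hc ω hω) (le_of_eq (Finset.sum_congr rfl fun k _ => ?_))
    by_cases hk : ω ∈ E k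
    · rw [Set.indicator_of_mem hk, Set.indicator_of_mem (Set.mem_inter hω hk)]
    · rw [Set.indicator_of_notMem hk, Set.indicator_of_notMem (fun h => hk h.2)]
  · simp only [Set.indicator_of_notMem hω]
    exact Finset.sum_nonneg fun k hk => Set.indicator_nonneg (fun _ _ => ha k hk) _

/-- **The star at `o` is independent of the configuration off `o`**: for an event `B` determined by the pairs off
`o` and a finite set `R` of vertices, `μ_w(B ∩ {all pairs s(o,x), x ∈ R, closed}) = μ_w(B) · ∏_{x∈R}(1 − w(o,x))`. [folklore] -/
theorem real_inter_starClosed (w : Sym2 (Fin n) → unitInterval) (o : Fin n) {B : Set (BondConfig (Fin n))}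
    (hB : DeterminedBy B (wireSet ({o}ᶜ : Set (Fin n)))) (R : Finset (Fin n)) :
    (prodBernoulli w).real (B ∩ {ω : BondConfig (Fin n) | ∀ x ∈ R, s(o, x) ∉ ω}) =
      (prodBernoulli w).real B * ∏ x ∈ R, (1 - (w s(o, x) : ℝ)) := by
  set F : Finset (Sym2 (Fin n)) := R.image fun x => s(o, x) with hF
  have hclosed : {ω : BondConfig (Fin n) | ∀ x ∈ R, s(o, x) ∉ ω} = {ω : BondConfig (Fin n) | ∀ e ∈ F, e ∉ ω} := by
    ext ω
    simp only [hF, mem_setOf_eq, Finset.mem_image, forall_exists_index, and_imp, forall_apply_eq_imp_iff₂]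
  have hA : DeterminedBy {ω : BondConfig (Fin n) | ∀ e ∈ F, e ∉ ω} (↑F : Set (Sym2 (Fin n))) := by
    rw [determinedBy_iff]
    intro ω ω' hωω'
    simp only [mem_setOf_eq]
    refine forall₂_congr fun e he => ?_
    have := Set.ext_iff.1 hωω' e
    simp only [mem_inter_iff, Finset.mem_coe, he, and_true] at this
    rw [this]
  have hB' : DeterminedBy B (↑F : Set (Sym2 (Fin n)))ᶜ := by
    refine hB.mono fun e he heF => ?_
    rw [hF, Finset.coe_image, Set.mem_image] at heF
    obtain ⟨x, -, rfl⟩ := heF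
    exact (mk_mem_wireSet_iff.1 he).1 rfl
  rw [Set.inter_comm, hclosed,
    prodBernoulli_real_inter_of_determinedBy w F hA hB' MeasurableSet.of_discrete MeasurableSet.of_discrete,
    prodBernoulli_real_forall_notMem, mul_comm, hF, Finset.prod_image]
  intro x _ y _ hxy
  exact Sym2.congr_right.1 hxy

/-- The off-`o` relay count `N^{off o}_x(ω) = |{a ∈ A : x ↔ a off o}|` reads only the pairs off `o`. [folklore] -/
theorem offCount_eq_of_inter_eq (A : Finset (Fin n)) (o x : Fin n) {ω ω' : BondConfig (Fin n)}
    (h : ω ∩ wireSet ({o}ᶜ : Set (Fin n)) = ω' ∩ wireSet ({o}ᶜ : Set (Fin n))) :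
    (A.filter fun a => ω ∈ openConnIn ({o}ᶜ : Set (Fin n)) x a).card =
      (A.filter fun a => ω' ∈ openConnIn ({o}ᶜ : Set (Fin n)) x a).card := by
  have key : ∀ a, (ω ∈ openConnIn ({o}ᶜ : Set (Fin n)) x a ↔ ω' ∈ openConnIn ({o}ᶜ : Set (Fin n)) x a) :=
    fun a => (determinedBy_iff _ _).1
      (KozmaNitzan.determinedBy_openConnIn_wireSet ({o}ᶜ : Set (Fin n)) x a subset_rfl) ω ω' h
  rw [Finset.filter_congr fun a _ => key a]

/-- **On the bad event, an off-`o`-light neighbour is `G ∖ s(o,x)`-light.**  If `1 ≤ N_o ≤ j` and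
`1 ≤ N^{off o}_x ≤ j` for some `x ≠ o`, then `1 ≤ N_x(ω ∖ s(o,x)) ≤ j`. [this work] -/
theorem lightSharp_of_light_of_bad (A : Finset (Fin n)) {o x : Fin n} (hxo : x ≠ o) (j : ℕ)
    {ω : BondConfig (Fin n)}
    (hbad : (A.filter fun a => ω ∈ openConn o a).card ≤ j)
    (h1 : 1 ≤ (A.filter fun a => ω ∈ openConnIn ({o}ᶜ : Set (Fin n)) x a).card)
    (hj : (A.filter fun a => ω ∈ openConnIn ({o}ᶜ : Set (Fin n)) x a).card ≤ j) :
    1 ≤ (A.filter fun a => ω \ {s(o, x)} ∈ openConn x a).card ∧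
      (A.filter fun a => ω \ {s(o, x)} ∈ openConn x a).card ≤ j := by
  constructor
  · -- an off-`o` path avoids the pair `s(o,x)`
    refine h1.trans (Finset.card_le_card fun a ha => ?_)
    rw [Finset.mem_filter] at ha ⊢
    exact ⟨ha.1, ObserverUnionBoundG.diff_mem_openConn_of_openConnIn x hxo ha.2⟩
  · by_cases hxoconn : ω \ {s(o, x)} ∈ openConn x o
    · -- the `ω ∖ s(o,x)`-cluster of `x` contains `o`: its relays are relays of `o` in `ω`
      refine le_trans (Finset.card_le_card fun a ha => ?_) hbad
      rw [Finset.mem_filter] at ha ⊢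
      refine ⟨ha.1, ?_⟩
      have hoa : ω \ {s(o, x)} ∈ openConn o a :=
        (hxoconn : (openGraph (ω \ {s(o, x)})).Reachable x o).symm.trans ha.2
      exact isUpperSet_openConn o a (ObserverUnionBoundG.diff_singleton_subset ω _) hoa
    · -- otherwise every vertex reachable from `x` in `ω ∖ s(o,x)` avoids `o`
      refine le_trans (Finset.card_le_card fun a ha => ?_) hj
      rw [Finset.mem_filter] at ha ⊢
      refine ⟨ha.1, ?_⟩
      have hS : ∀ y, (openGraph (ω \ {s(o, x)})).Reachable x y → y ∈ ({o}ᶜ : Set (Fin n)) := by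
        intro y hy hyo
        rw [mem_singleton_iff] at hyo
        rw [hyo] at hy
        exact hxoconn hy
      have h' : ω \ {s(o, x)} ∈ openConnIn ({o}ᶜ : Set (Fin n)) x a :=
        KNGoodAux.openConnIn_of_reachable_of_forall_mem ha.2 hS
      have h'' := (KNGoodAux.inter_wireSet_mem_openConn_iff (ω := ω \ {s(o, x)})
        (S := ({o}ᶜ : Set (Fin n))) (mem_compl_singleton_iff.2 hxo) a).2 h'
      refine (KNGoodAux.inter_wireSet_mem_openConn_iff (mem_compl_singleton_iff.2 hxo) a).1 ?_
      exact isUpperSet_openConn x a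
        (Set.inter_subset_inter_left _ (ObserverUnionBoundG.diff_singleton_subset ω _)) h''

/-- On `{1 ≤ N_o ≤ j}` no pair from `o` to a HEAVY off-`o` neighbour (`j < N^{off o}_x`) is open. [this work] -/
theorem closed_of_heavy_of_bad (A : Finset (Fin n)) {o x : Fin n} (hxo : x ≠ o) (j : ℕ)
    {ω : BondConfig (Fin n)}
    (hbad : (A.filter fun a => ω ∈ openConn o a).card ≤ j)
    (hheavy : j < (A.filter fun a => ω ∈ openConnIn ({o}ᶜ : Set (Fin n)) x a).card) :
    s(o, x) ∉ ω := by
  intro he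
  have hsub : (A.filter fun a => ω ∈ openConnIn ({o}ᶜ : Set (Fin n)) x a) ⊆ (A.filter fun a => ω ∈ openConn o a) := by
    intro a ha
    rw [Finset.mem_filter] at ha ⊢
    exact ⟨ha.1, ObserverUnionBound.openConn_of_edge_of_openConnIn hxo he ha.2⟩
  have := Finset.card_le_card hsub
  omega

/-- If `o ↔ a` for some relay `a`, then some pair `s(o,x)` with `x` attached to `A` off `o` is open; so on
"all pairs to the attached neighbours closed" the observer misses `A`. [this work] -/
theorem exists_open_attached_of_openConn (A : Finset (Fin n)) (o : Fin n) (ho : o ∉ A) {ω : BondConfig (Fin n)}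
    {a : Fin n} (haA : a ∈ A) (hoa : ω ∈ openConn o a) :
    ∃ x : Fin n, x ≠ o ∧ s(o, x) ∈ ω ∧ 1 ≤ (A.filter fun a' => ω ∈ openConnIn ({o}ᶜ : Set (Fin n)) x a').card := by
  have hao : a ≠ o := fun h => ho (h ▸ haA)
  obtain ⟨p⟩ := (hoa : (openGraph ω).Reachable o a)
  obtain ⟨x, hxB, hxo, hxa⟩ := (KNPreFKG.walk_decomp (ObserverUnionBound.mem_starEvent_self o ω) p hao).2 rfl
  exact ⟨x, hxo, hxB, Finset.card_pos.2 ⟨a, Finset.mem_filter.2 ⟨haA, hxa⟩⟩⟩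

/-! ### The Markov first-edge bound -/

/-- **The Markov first-edge bound.**  `o ∉ A`, all pairs at `o` of weight `< 1`, `α_x = −log(1 − w(o,x))`.
For every `λ > 0`:
`μ_w(1 ≤ N_o ≤ j) ≤ e^{2λ}·μ_w((⋃_{a∈A}{o ↔ a})ᶜ) + e^{−λ} + (1/λ)·Σ_{x ≠ o} α_x · μ_{pinW w {s(o,x)} ∅}(1 ≤ N_x ≤ j)`.
[this work] -/
theorem lowerTail_le_markov_firstEdge (w : Sym2 (Fin n) → unitInterval) (A : Finset (Fin n)) (o : Fin n)
    (ho : o ∉ A) (j : ℕ) (hw1 : ∀ x : Fin n, x ≠ o → (w s(o, x) : ℝ) < 1) (lam : ℝ) (hlam : 0 < lam) :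
    (prodBernoulli w).real {ω : BondConfig (Fin n) |
        1 ≤ (A.filter fun a => ω ∈ openConn o a).card ∧ (A.filter fun a => ω ∈ openConn o a).card ≤ j} ≤
      Real.exp (2 * lam) * (prodBernoulli w).real (⋃ a ∈ A, (openConn o a : Set (BondConfig (Fin n))))ᶜ +
        Real.exp (-lam) +
        (1 / lam) * ∑ x ∈ (Finset.univ.filter fun x : Fin n => x ≠ o),
          (-Real.log (1 - (w s(o, x) : ℝ))) *
            (prodBernoulli (pinW w ({s(o, x)} : Set (Sym2 (Fin n))) ∅)).real
              {ω : BondConfig (Fin n) | 1 ≤ (A.filter fun a => ω ∈ openConn x a).card ∧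
                (A.filter fun a => ω ∈ openConn x a).card ≤ j} := by
  set μ := prodBernoulli w with hμ
  -- bookkeeping
  set P : Finset (Fin n) := Finset.univ.filter fun x : Fin n => x ≠ o with hP
  set NH : BondConfig (Fin n) → Fin n → ℕ :=
    fun ω x => (A.filter fun a => ω ∈ openConnIn ({o}ᶜ : Set (Fin n)) x a).card with hNH
  set NS : BondConfig (Fin n) → Fin n → ℕ :=
    fun ω x => (A.filter fun a => ω \ {s(o, x)} ∈ openConn x a).card with hNS
  set No : BondConfig (Fin n) → ℕ := fun ω => (A.filter fun a => ω ∈ openConn o a).card with hNo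
  set S : BondConfig (Fin n) → Finset (Fin n) := fun ω => P.filter fun x => 1 ≤ NH ω x with hS
  set Sh : BondConfig (Fin n) → Finset (Fin n) := fun ω => P.filter fun x => j < NH ω x with hSh
  set Sl : BondConfig (Fin n) → Finset (Fin n) := fun ω => P.filter fun x => 1 ≤ NH ω x ∧ NH ω x ≤ j with hSl
  set q : Finset (Fin n) → ℝ := fun R => ∏ x ∈ R, (1 - (w s(o, x) : ℝ)) with hq
  set α : Fin n → ℝ := fun x => -Real.log (1 - (w s(o, x) : ℝ)) with hα
  set bad : Set (BondConfig (Fin n)) := {ω | 1 ≤ No ω ∧ No ω ≤ j} with hbad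
  set C1 : Set (BondConfig (Fin n)) := {ω | Real.exp (-(2 * lam)) ≤ q (S ω)} with hC1
  set D2 : Set (BondConfig (Fin n)) := {ω | q (Sh ω) < Real.exp (-lam)} with hD2
  set D3 : Set (BondConfig (Fin n)) := {ω | q (Sl ω) < Real.exp (-lam)} with hD3
  set E : Fin n → Set (BondConfig (Fin n)) := fun x => {ω | 1 ≤ NS ω x ∧ NS ω x ≤ j} with hE
  set D3' : Set (BondConfig (Fin n)) := {ω | lam < ∑ x ∈ P, (E x).indicator (fun _ => α x) ω} with hD3'
  have hmeas : ∀ s : Set (BondConfig (Fin n)), MeasurableSet s := fun _ => MeasurableSet.of_discrete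
  have hPo : ∀ x ∈ P, x ≠ o := fun x hx => (Finset.mem_filter.1 hx).2
  -- weights: positivity, `α ≥ 0`, `q R = exp (-Σ α)` on subsets of `P`, `0 ≤ q R ≤ 1`
  have hwpos : ∀ x ∈ P, 0 < 1 - (w s(o, x) : ℝ) := fun x hx => by linarith [hw1 x (hPo x hx)]
  have hαnn : ∀ x ∈ P, 0 ≤ α x := fun x hx => by
    have := Real.log_nonpos (hwpos x hx).le (by linarith [(w s(o, x)).2.1] : 1 - (w s(o, x) : ℝ) ≤ 1)
    simp only [hα]; linarith
  have hqexp : ∀ R ⊆ P, q R = Real.exp (-(∑ x ∈ R, α x)) := by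
    intro R hR
    simp only [hq, hα, Finset.sum_neg_distrib, neg_neg, Real.exp_sum]
    exact Finset.prod_congr rfl fun x hx => (Real.exp_log (hwpos x (hR hx))).symm
  have hq_nn : ∀ R, 0 ≤ q R := fun R => Finset.prod_nonneg fun x _ => by linarith [(w s(o, x)).2.2]
  have hSsub : ∀ ω, S ω ⊆ P := fun ω => Finset.filter_subset _ _
  -- `S = Sh ⊔ Sl`, hence `q S = q Sh * q Sl`
  have hqS : ∀ ω, q (S ω) = q (Sh ω) * q (Sl ω) := by
    intro ω
    have hunion : S ω = Sh ω ∪ Sl ω := by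
      ext x
      simp only [hS, hSh, hSl, Finset.mem_filter, Finset.mem_union]
      constructor
      · rintro ⟨hx, h1⟩
        by_cases hjx : j < NH ω x
        · exact Or.inl ⟨hx, hjx⟩
        · exact Or.inr ⟨hx, h1, not_lt.1 hjx⟩
      · rintro (⟨hx, hjx⟩ | ⟨hx, h1, _⟩) <;> [exact ⟨hx, by omega⟩; exact ⟨hx, h1⟩]
    have hdisj : Disjoint (Sh ω) (Sl ω) := Finset.disjoint_left.2 fun x hx hx' => by
      simp only [hSh, hSl, Finset.mem_filter] at hx hx'; omega
    simp only [hq]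
    rw [hunion, Finset.prod_union hdisj]
  -- the events `{S = R}`, `{Sh = R}` read only the pairs off `o`
  have hdetS : ∀ R, DeterminedBy {ω : BondConfig (Fin n) | S ω = R} (wireSet ({o}ᶜ : Set (Fin n))) := fun R =>
    (determinedBy_iff _ _).2 fun ω ω' h => by
      simp only [mem_setOf_eq, hS, (funext fun x => offCount_eq_of_inter_eq A o x h : NH ω = NH ω')]
  have hdetSh : ∀ R, DeterminedBy {ω : BondConfig (Fin n) | Sh ω = R} (wireSet ({o}ᶜ : Set (Fin n))) := fun R =>
    (determinedBy_iff _ _).2 fun ω ω' h => by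
      simp only [mem_setOf_eq, hSh, (funext fun x => offCount_eq_of_inter_eq A o x h : NH ω = NH ω')]
  have hdisjF : ∀ (F : BondConfig (Fin n) → Finset (Fin n)) (R R' : Finset (Fin n)), R ≠ R' →
      Disjoint {ω : BondConfig (Fin n) | F ω = R} {ω : BondConfig (Fin n) | F ω = R'} :=
    fun F R R' hne => Set.disjoint_left.2 fun ω h h' => hne ((h.symm.trans h' : R = R'))
  -- STEP 0: the cover `bad ⊆ C1 ∪ (bad ∩ D2) ∪ (bad ∩ D3)`
  have hcover : bad ⊆ C1 ∪ (bad ∩ D2) ∪ (bad ∩ D3) := by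
    intro ω hω
    by_cases h1 : ω ∈ C1
    · exact Or.inl (Or.inl h1)
    by_cases h2 : ω ∈ D2
    · exact Or.inl (Or.inr ⟨hω, h2⟩)
    refine Or.inr ⟨hω, ?_⟩
    simp only [hC1, hD2, hD3, mem_setOf_eq, not_le, not_lt] at h1 h2 ⊢
    by_contra h3
    rw [not_lt] at h3
    have : Real.exp (-(2 * lam)) ≤ q (S ω) := by
      rw [hqS ω, show -(2 * lam) = -lam + -lam by ring, Real.exp_add]
      exact mul_le_mul h2 h3 (Real.exp_pos _).le (hq_nn _)
    linarith
  -- STEP 1: `μ(C1) ≤ e^{2λ} δ₀`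
  have hstep1 : μ.real C1 ≤ Real.exp (2 * lam) * μ.real (⋃ a ∈ A, (openConn o a : Set (BondConfig (Fin n))))ᶜ := by
    set I1 : Finset (Finset (Fin n)) := P.powerset.filter fun R => Real.exp (-(2 * lam)) ≤ q R with hI1
    have hdec : C1 = ⋃ R ∈ I1, {ω : BondConfig (Fin n) | S ω = R} := by
      ext ω
      simp only [hC1, hI1, mem_setOf_eq, Set.mem_iUnion, Finset.mem_filter, Finset.mem_powerset, exists_prop]
      constructor
      · intro h; exact ⟨S ω, ⟨hSsub ω, h⟩, rfl⟩
      · rintro ⟨R, ⟨-, hR⟩, hSR⟩; rw [hSR]; exact hR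
    have hdisj := hdisjF S
    have hsum : μ.real C1 = ∑ R ∈ I1, μ.real {ω : BondConfig (Fin n) | S ω = R} := by
      rw [hdec, measureReal_biUnion_finset (fun R _ R' _ hne => hdisj R R' hne) fun R _ => hmeas _]
    -- each term: `e^{-2λ} μ{S = R} ≤ q R · μ{S = R} = μ({S = R} ∩ closed_R)`
    have hterm : ∀ R ∈ I1, Real.exp (-(2 * lam)) * μ.real {ω : BondConfig (Fin n) | S ω = R} ≤
        μ.real ({ω : BondConfig (Fin n) | S ω = R} ∩ {ω : BondConfig (Fin n) | ∀ x ∈ R, s(o, x) ∉ ω}) := by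
      intro R hR
      have hRq := (Finset.mem_filter.1 hR).2
      rw [real_inter_starClosed w o (hdetS R) R, mul_comm]
      exact mul_le_mul_of_nonneg_left hRq measureReal_nonneg
    -- the events `{S = R} ∩ closed_R` are disjoint pieces of `{o ↮ A}`
    have hsub : (⋃ R ∈ I1, ({ω : BondConfig (Fin n) | S ω = R} ∩ {ω : BondConfig (Fin n) | ∀ x ∈ R, s(o, x) ∉ ω})) ⊆
        (⋃ a ∈ A, (openConn o a : Set (BondConfig (Fin n))))ᶜ := by
      intro ω hω
      rw [Set.mem_iUnion₂] at hω
      obtain ⟨R, -, hSR, hcl⟩ := hω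
      rw [Set.mem_compl_iff, Set.mem_iUnion₂]
      rintro ⟨a, haA, hoa⟩
      obtain ⟨x, hxo, hx, h1⟩ := exists_open_attached_of_openConn A o ho haA hoa
      have hxS : x ∈ S ω := Finset.mem_filter.2 ⟨Finset.mem_filter.2 ⟨Finset.mem_univ _, hxo⟩, h1⟩
      rw [(hSR : S ω = R)] at hxS
      exact hcl x hxS hx
    have hle : Real.exp (-(2 * lam)) * μ.real C1 ≤ μ.real (⋃ a ∈ A, (openConn o a : Set (BondConfig (Fin n))))ᶜ := by
      calc Real.exp (-(2 * lam)) * μ.real C1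
          = ∑ R ∈ I1, Real.exp (-(2 * lam)) * μ.real {ω : BondConfig (Fin n) | S ω = R} := by
            rw [hsum, Finset.mul_sum]
        _ ≤ ∑ R ∈ I1, μ.real ({ω : BondConfig (Fin n) | S ω = R} ∩ {ω : BondConfig (Fin n) | ∀ x ∈ R, s(o, x) ∉ ω}) :=
            Finset.sum_le_sum hterm
        _ = μ.real (⋃ R ∈ I1, ({ω : BondConfig (Fin n) | S ω = R} ∩ {ω : BondConfig (Fin n) | ∀ x ∈ R, s(o, x) ∉ ω})) := by
            rw [measureReal_biUnion_finset (fun R _ R' _ hne => (hdisj R R' hne).mono Set.inter_subset_left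
              Set.inter_subset_left) fun R _ => hmeas _]
        _ ≤ μ.real (⋃ a ∈ A, (openConn o a : Set (BondConfig (Fin n))))ᶜ := measureReal_mono hsub (measure_ne_top _ _)
    have hexp : Real.exp (2 * lam) * Real.exp (-(2 * lam)) = 1 := by rw [← Real.exp_add]; simp
    calc μ.real C1 = Real.exp (2 * lam) * (Real.exp (-(2 * lam)) * μ.real C1) := by
          rw [← mul_assoc, hexp, one_mul]
      _ ≤ Real.exp (2 * lam) * μ.real (⋃ a ∈ A, (openConn o a : Set (BondConfig (Fin n))))ᶜ :=
          mul_le_mul_of_nonneg_left hle (Real.exp_pos _).le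
  -- STEP 2: `μ(bad ∩ D2) ≤ e^{-λ}`
  have hstep2 : μ.real (bad ∩ D2) ≤ Real.exp (-lam) := by
    set I2 : Finset (Finset (Fin n)) := P.powerset.filter fun R => q R < Real.exp (-lam) with hI2
    have hdisj := hdisjF Sh
    have hsub : bad ∩ D2 ⊆ ⋃ R ∈ I2, ({ω : BondConfig (Fin n) | Sh ω = R} ∩ {ω : BondConfig (Fin n) | ∀ x ∈ R, s(o, x) ∉ ω}) := by
      rintro ω ⟨hωbad, hωD2⟩
      rw [Set.mem_iUnion₂]
      refine ⟨Sh ω, Finset.mem_filter.2 ⟨Finset.mem_powerset.2 (Finset.filter_subset _ _), hωD2⟩, rfl, fun x hx => ?_⟩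
      obtain ⟨hxP, hheavy⟩ := Finset.mem_filter.1 hx
      exact closed_of_heavy_of_bad A (hPo x hxP) j hωbad.2 hheavy
    calc μ.real (bad ∩ D2)
        ≤ μ.real (⋃ R ∈ I2, ({ω : BondConfig (Fin n) | Sh ω = R} ∩ {ω : BondConfig (Fin n) | ∀ x ∈ R, s(o, x) ∉ ω})) :=
          measureReal_mono hsub (measure_ne_top _ _)
      _ ≤ ∑ R ∈ I2, μ.real ({ω : BondConfig (Fin n) | Sh ω = R} ∩ {ω : BondConfig (Fin n) | ∀ x ∈ R, s(o, x) ∉ ω}) :=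
          measureReal_biUnion_finset_le _ _
      _ = ∑ R ∈ I2, μ.real {ω : BondConfig (Fin n) | Sh ω = R} * q R := by
          refine Finset.sum_congr rfl fun R _ => ?_
          exact real_inter_starClosed w o (hdetSh R) R
      _ ≤ ∑ R ∈ I2, μ.real {ω : BondConfig (Fin n) | Sh ω = R} * Real.exp (-lam) :=
          Finset.sum_le_sum fun R hR => mul_le_mul_of_nonneg_left (Finset.mem_filter.1 hR).2.le measureReal_nonneg
      _ = (∑ R ∈ I2, μ.real {ω : BondConfig (Fin n) | Sh ω = R}) * Real.exp (-lam) := by rw [Finset.sum_mul]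
      _ = μ.real (⋃ R ∈ I2, {ω : BondConfig (Fin n) | Sh ω = R}) * Real.exp (-lam) := by
          rw [measureReal_biUnion_finset (fun R _ R' _ hne => hdisj R R' hne) fun R _ => hmeas _]
      _ ≤ 1 * Real.exp (-lam) := mul_le_mul_of_nonneg_right measureReal_le_one (Real.exp_pos _).le
      _ = Real.exp (-lam) := one_mul _
  -- STEP 3: `μ(bad ∩ D3) ≤ (1/λ) Σ_x α_x μ_{G∖ox}(1 ≤ N_x ≤ j)`
  have hstep3 : μ.real (bad ∩ D3) ≤ (1 / lam) * ∑ x ∈ P, α x *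
      (prodBernoulli (pinW w ({s(o, x)} : Set (Sym2 (Fin n))) ∅)).real
        {ω : BondConfig (Fin n) | 1 ≤ (A.filter fun a => ω ∈ openConn x a).card ∧
          (A.filter fun a => ω ∈ openConn x a).card ≤ j} := by
    -- on `bad ∩ D3` the sharp-light weight exceeds `λ`
    have hsub : bad ∩ D3 ⊆ D3' := by
      rintro ω ⟨hωbad, hωD3⟩
      simp only [hD3', mem_setOf_eq]
      -- `Sl ω ⊆ {x ∈ P | ω ∈ E x}`
      have hSlE : Sl ω ⊆ P.filter fun x => ω ∈ E x := by
        intro x hx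
        obtain ⟨hxP, h1, hj⟩ := Finset.mem_filter.1 hx
        exact Finset.mem_filter.2 ⟨hxP, lightSharp_of_light_of_bad A (hPo x hxP) j hωbad.2 h1 hj⟩
      have hsumE : ∑ x ∈ P, (E x).indicator (fun _ => α x) ω = ∑ x ∈ P.filter (fun x => ω ∈ E x), α x := by
        simp only [Set.indicator_apply]
        rw [Finset.sum_ite, Finset.sum_const_zero, add_zero]
      rw [hsumE]
      have hlt : lam < ∑ x ∈ Sl ω, α x := by
        have hD : q (Sl ω) < Real.exp (-lam) := hωD3
        rw [hqexp (Sl ω) (Finset.filter_subset _ _), Real.exp_lt_exp] at hD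
        linarith
      exact lt_of_lt_of_le hlt (Finset.sum_le_sum_of_subset_of_nonneg hSlE fun x hx _ => hαnn x (Finset.mem_filter.1 hx).1)
    have hmk := mul_measureReal_le_sum_weighted μ P E α hαnn (fun x _ => hmeas _) (hmeas D3') lam
      (fun ω hω => (le_of_lt hω))
    have hE_eq : ∀ x ∈ P, μ.real (E x) =
        (prodBernoulli (pinW w ({s(o, x)} : Set (Sym2 (Fin n))) ∅)).real
          {ω : BondConfig (Fin n) | 1 ≤ (A.filter fun a => ω ∈ openConn x a).card ∧
            (A.filter fun a => ω ∈ openConn x a).card ≤ j} := by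
      intro x _
      exact ObserverUnionBoundG.real_preimage_diff_eq_pinW w
        {ω' : BondConfig (Fin n) | 1 ≤ (A.filter fun a => ω' ∈ openConn x a).card ∧
          (A.filter fun a => ω' ∈ openConn x a).card ≤ j} s(o, x)
    have hsum_le : ∑ x ∈ P, α x * μ.real (D3' ∩ E x) ≤ ∑ x ∈ P, α x *
        (prodBernoulli (pinW w ({s(o, x)} : Set (Sym2 (Fin n))) ∅)).real
          {ω : BondConfig (Fin n) | 1 ≤ (A.filter fun a => ω ∈ openConn x a).card ∧
            (A.filter fun a => ω ∈ openConn x a).card ≤ j} := by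
      refine Finset.sum_le_sum fun x hx => ?_
      rw [← hE_eq x hx]
      exact mul_le_mul_of_nonneg_left (measureReal_mono Set.inter_subset_right (measure_ne_top _ _)) (hαnn x hx)
    calc μ.real (bad ∩ D3) ≤ μ.real D3' := measureReal_mono hsub (measure_ne_top _ _)
      _ = (1 / lam) * (lam * μ.real D3') := by field_simp
      _ ≤ (1 / lam) * ∑ x ∈ P, α x * μ.real (D3' ∩ E x) :=
          mul_le_mul_of_nonneg_left hmk (by positivity)
      _ ≤ _ := mul_le_mul_of_nonneg_left hsum_le (by positivity)
  -- assemble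
  calc μ.real bad ≤ μ.real (C1 ∪ (bad ∩ D2) ∪ (bad ∩ D3)) := measureReal_mono hcover (measure_ne_top _ _)
    _ ≤ μ.real (C1 ∪ (bad ∩ D2)) + μ.real (bad ∩ D3) := measureReal_union_le _ _
    _ ≤ μ.real C1 + μ.real (bad ∩ D2) + μ.real (bad ∩ D3) := by
        have := measureReal_union_le (μ := μ) C1 (bad ∩ D2); linarith
    _ ≤ _ := by linarith [hstep1, hstep2, hstep3]

end MarkovFirstEdge

end

end Summit.CriticalPhenomena.PercolationContinuityZ3.Theorems
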